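import Mathlib
import HarnessLib
import Summits.AtomisticToContinuum.Crystallization.Theorems.PricedLinkCensusSoftFourRingsVertexFan

/-!
# Soft four-rings, endgame groundwork: the two bond triangles at a vertex with `t_v = 2`

Support file for `SoftFourRings` (route `PricedLinkCensus`, sub-problem `Crystallization`),
endgame step (E1) of the evidence file (§12.8).  In the setting of
`PricedLinkCensusSoftFourRingsVertexFan` (a vertex `v` with bonds exactly `w 0, …, w 3`), if
exactly two bond triangles pass through `v` then the bonded pairs of the link are EXACTLY two
distinct index pairs `{i₁, j₁} ≠ {i₂, j₂}` (`bondedPairs_of_two_bondTriangles_at`); two distinct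
pairs of a four-set are either disjoint (type O: the link is a perfect matching) or share one index
(type A: the link is a path of length two plus an isolated vertex) — `fin_four_pairs_dichotomy`.
-/

namespace Summit.AtomisticToContinuum.Crystallization.Theorems

open Real RealInnerProductSpace Literature.Geometry.DiscreteGeometry

/-- **Two distinct pairs of `Fin 4`** are disjoint or share exactly one index: after renaming,
`p = {i, j}` and `q = {k, l}` or `q = {j, k}` with `i, j, k, l` pairwise distinct. -/
theorem fin_four_pairs_dichotomy {i₁ j₁ i₂ j₂ : Fin 4} (h₁ : i₁ ≠ j₁) (h₂ : i₂ ≠ j₂)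
    (hne : ({i₁, j₁} : Finset (Fin 4)) ≠ {i₂, j₂}) :
    ∃ i j k l : Fin 4, [i, j, k, l].Nodup ∧ ({i₁, j₁} : Finset (Fin 4)) = {i, j} ∧
      (({i₂, j₂} : Finset (Fin 4)) = {k, l} ∨ ({i₂, j₂} : Finset (Fin 4)) = {j, k}) := by
  revert i₁ j₁ i₂ j₂
  decide

section Bonds

variable {X : Finset (EuclideanSpace ℝ (Fin 3))} {B : Finset (Finset (EuclideanSpace ℝ (Fin 3)))}

variable (hX1 : ∀ y ∈ X, ‖y‖ = 1)
  (h0 : (0 : EuclideanSpace ℝ (Fin 3)) ∈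
    interior (convexHull ℝ (X : Set (EuclideanSpace ℝ (Fin 3)))))
  (hsepX : ∀ u ∈ X, ∀ u' ∈ X, u ≠ u' → ⟪u, u'⟫ ≤ 1 - 1 / (2 * (101 / 100 : ℝ) ^ 2))
  (hB : ∀ T ∈ B, ∃ u ∈ X, ∃ u' ∈ X, u ≠ u' ∧ 1 - (101 / 100 : ℝ) ^ 2 / 2 ≤ ⟪u, u'⟫ ∧ T = {u, u'})
  {v : EuclideanSpace ℝ (Fin 3)} (hv : v ∈ X) (w : Fin 4 → EuclideanSpace ℝ (Fin 3))
  (hwX : ∀ k, w k ∈ X) (hwinj : Function.Injective w) (hwv : ∀ k, w k ≠ v)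
  (hvw : ∀ k, ({v, w k} : Finset (EuclideanSpace ℝ (Fin 3))) ∈ B)
  (hvonly : ∀ y, ({v, y} : Finset (EuclideanSpace ℝ (Fin 3))) ∈ B → ∃ k, y = w k)

include hwinj hwv in
/-- Index pairs are recovered from the triangle: `{v, w a, w b} = {v, w i, w j}` gives
`{a, b} = {i, j}`. -/
theorem pair_eq_of_triangle_eq {a b i j : Fin 4}
    (h : ({v, w a, w b} : Finset (EuclideanSpace ℝ (Fin 3))) = {v, w i, w j}) :
    ({a, b} : Finset (Fin 4)) = {i, j} := by
  classical
  rw [← filter_mem_three_eq w hwinj hwv a b, ← filter_mem_three_eq w hwinj hwv i j, h]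

include hX1 h0 hsepX hB hv hwX hwinj hwv hvw hvonly in
open scoped Classical in
/-- **(E1) Exactly two bond triangles at `v` ⇒ exactly two bonded pairs in the link.**  If
`t_v = 2` then there are index pairs `{i₁, j₁} ≠ {i₂, j₂}` with `{w i₁, w j₁}, {w i₂, w j₂} ∈ B`,
and every bonded pair of the link is one of them. -/
theorem bondedPairs_of_two_bondTriangles_at
    (ht2 : ((facetNormals X).filter (fun c => v ∈ tightSet X c ∧ (tightSet X c).card = 3 ∧
      ((edgesOfFacet X c).filter (fun T => T ∉ B)).card = 0)).card = 2) :
    ∃ i₁ j₁ i₂ j₂ : Fin 4, i₁ ≠ j₁ ∧ i₂ ≠ j₂ ∧ ({i₁, j₁} : Finset (Fin 4)) ≠ {i₂, j₂} ∧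
      ({w i₁, w j₁} : Finset (EuclideanSpace ℝ (Fin 3))) ∈ B ∧
      ({w i₂, w j₂} : Finset (EuclideanSpace ℝ (Fin 3))) ∈ B ∧
      ∀ a b : Fin 4, a ≠ b → ({w a, w b} : Finset (EuclideanSpace ℝ (Fin 3))) ∈ B →
        ({a, b} : Finset (Fin 4)) = {i₁, j₁} ∨ ({a, b} : Finset (Fin 4)) = {i₂, j₂} := by
  set F := (facetNormals X).filter (fun c => v ∈ tightSet X c ∧ (tightSet X c).card = 3 ∧
      ((edgesOfFacet X c).filter (fun T => T ∉ B)).card = 0) with hF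
  obtain ⟨c₁, c₂, hc12, hFeq⟩ := Finset.card_eq_two.1 ht2
  have hc₁ : c₁ ∈ F := by rw [hFeq]; simp
  have hc₂ : c₂ ∈ F := by rw [hFeq]; simp
  obtain ⟨hc₁F, hvc₁, h3₁, hnb₁⟩ := Finset.mem_filter.1 hc₁
  obtain ⟨hc₂F, hvc₂, h3₂, hnb₂⟩ := Finset.mem_filter.1 hc₂
  obtain ⟨i₁, j₁, hij₁, hT₁, hB₁⟩ := tightSet_bondTriangle_at hX1 h0 w hvonly hc₁F h3₁ hnb₁ hvc₁
  obtain ⟨i₂, j₂, hij₂, hT₂, hB₂⟩ := tightSet_bondTriangle_at hX1 h0 w hvonly hc₂F h3₂ hnb₂ hvc₂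
  refine ⟨i₁, j₁, i₂, j₂, hij₁, hij₂, ?_, hB₁, hB₂, ?_⟩
  · -- distinct facets have distinct tight sets
    intro heq
    apply hc12
    refine (mem_facetNormals.1 hc₁F).eq_of_tightSet_eq ?_
    rw [hT₁, hT₂]
    -- `{v, w i₁, w j₁} = {v, w i₂, w j₂}` from `{i₁, j₁} = {i₂, j₂}`
    have himg : ∀ i j : Fin 4, ({v, w i, w j} : Finset (EuclideanSpace ℝ (Fin 3))) =
        insert v (({i, j} : Finset (Fin 4)).image w) := by
      intro i j
      rw [Finset.image_insert, Finset.image_singleton]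
    rw [himg, himg, heq]
  · intro a b hab hBab
    obtain ⟨c, hcF', hcT, hcnb⟩ :=
      bondTriangle_at_of_mem_bonds hX1 hsepX hB hv w hwX hwinj hwv hvw hab hBab
    have hc3 : (tightSet X c).card = 3 := by
      rw [hcT, Finset.card_insert_of_notMem, Finset.card_pair (fun h => hab (hwinj h))]
      simp only [Finset.mem_insert, Finset.mem_singleton, not_or]
      exact ⟨(hwv a).symm, (hwv b).symm⟩
    have hvc : v ∈ tightSet X c := by rw [hcT]; simp
    have hcmem : c ∈ F := Finset.mem_filter.2 ⟨hcF', hvc, hc3, hcnb⟩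
    rw [hFeq, Finset.mem_insert, Finset.mem_singleton] at hcmem
    rcases hcmem with rfl | rfl
    · left
      exact pair_eq_of_triangle_eq w hwinj hwv (hcT.symm.trans hT₁)
    · right
      exact pair_eq_of_triangle_eq w hwinj hwv (hcT.symm.trans hT₂)

end Bonds

end Summit.AtomisticToContinuum.Crystallization.Theorems
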